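import Literature.Geometry.Riemannian.PerelmanEntropyPointwise
import HarnessLib

/-!
# Topping's entropy integrand `v`, the conjugate heat operator `□*`, and the final conditional
# form of Perelman's no local collapsing theorem in that vocabulary

`PerelmanEntropyPointwise.lean` reduces the named fact `perelman_noLocalCollapsing`
(`CanonicalNeighbourhoods.lean`; Perelman 2002, §4, Thm. 4.1) to two statements about closed
manifolds modelled on `ℝ^m` carrying a Ricci flow — (CH) backward solvability of the conjugate
heat equation and (P) the pointwise inequality of Topping's Prop. 8.2.6 — but spells Topping's
`v = [τ(2Δf − |∇f|² + R) + f − n] u` (2006, (8.2.3)) and `□* = −∂ₜ − Δ + R` (§6.3) out in full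
at every occurrence. This file names them (definitions with bodies, O'Neill/Topping vocabulary
of the layer) and restates the reduction in the named form, so that the remaining analytic
target (P) reads `□* v ≤ 0`:

* `conjugateHeatOp g cov S w t x = −∂ₜw − Δ_{g(t)} w(t) + R w` — **the conjugate heat operator**
  `□*` (Topping 2006, §6.3; Perelman 2002, §3.1), `∂ₜ` the one-sided `derivWithin` in the time
  set `S`, `Δ = laplaceBeltrami`, `R = scalarCurvatureWith`;
* `entropyPotential u n τ₀ t x = −log u(t, x) − (n/2) log (4π(τ₀ − t))` — the potential `f` with
  `u = (4πτ)^{-n/2} e^{-f}`, `τ = τ₀ − t` (Topping (8.1.1), (8.2.1));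
* `entropyIntegrand g cov u n τ₀ t x = [(τ₀ − t)(2Δf − |∇f|² + R) + f − n] u` — **Topping's `v`**
  (2006, (8.2.3)), whose integral is `𝒲` (Rem. 8.2.7, `wEntropy_eq_integral_conjugateHeatIntegrand`);
* `IsConjugateHeatSolutionOn g cov S u` — `u` is `C^∞` on `M × S` and `□* u = 0` there (the
  equation of Topping Rem. 8.2.2 / Perelman §3.1 in the `derivWithin` encoding of the layer);
* `IsRicciFlow.monotoneOn_wEntropy_of_conjugateHeatOp_entropyIntegrand_nonpos` — (EF)(b) from
  `□* v ≤ 0` (restating `monotoneOn_wEntropy_of_pointwise`);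
* `perelman_noLocalCollapsing_of_conjugateHeatSolution` — **the named fact follows from
  (CH) `∀` smooth positive final data `∃` a positive conjugate heat solution on `[0, t₀]`, and
  (P) `□* v ≤ 0` along positive conjugate heat solutions, on closed manifolds modelled on `ℝ^m`**
  (restating `perelman_noLocalCollapsing_of_conjugateHeat_pointwise`). NOT a discharge.

## References

* P. Topping, *Lectures on the Ricci flow*, LMS Lecture Note Series 325, CUP 2006, §6.3
  (`□*`), §8.1 (8.1.1), §8.2 (8.2.1), (8.2.3), Prop. 8.2.6, Rem. 8.2.2, Rem. 8.2.5, Rem. 8.2.7.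
  [Topping2006]
* G. Perelman, *The entropy formula for the Ricci flow and its geometric applications*,
  arXiv:math/0211159 (2002), §3.1 ("`□* = −∂/∂t − Δ + R` is the conjugate heat operator"),
  §4, Thm. 4.1. [Perelman2002]
-/

noncomputable section

open Set Function Filter Manifold Bundle MeasureTheory Module
open scoped Manifold ContDiff Topology ENNReal

namespace Literature.Geometry.Riemannian

open Lorentzian Lorentzian.PseudoRiemannianMetric

universe u v w

section Potential

variable {M : Type*}

/-- **The potential of a positive density**: `f(t, x) = −log u(t, x) − (n/2) log (4π(τ₀ − t))`,
so that `u = (4πτ)^{-n/2} e^{-f}` with `τ = τ₀ − t` (Topping 2006, (8.1.1) and the substitution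
of Rem. 8.2.2; `entropyDensity_neg_log`). [cite: Topping2006, §8.1, (8.1.1)] -/
def entropyPotential (u : ℝ → M → ℝ) (n : ℕ) (τ₀ t : ℝ) (x : M) : ℝ :=
  -Real.log (u t x) - (n : ℝ) / 2 * Real.log (4 * Real.pi * (τ₀ - t))

/-- Unfolding of the potential. [cite: Topping2006, §8.1, (8.1.1)] -/
theorem entropyPotential_apply (u : ℝ → M → ℝ) (n : ℕ) (τ₀ t : ℝ) (x : M) :
    entropyPotential u n τ₀ t x = -Real.log (u t x) - (n : ℝ) / 2 * Real.log (4 * Real.pi * (τ₀ - t)) :=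
  rfl

end Potential

section Defs

variable {E : Type*} [NormedAddCommGroup E] [NormedSpace ℝ E] [FiniteDimensional ℝ E]
  [CompleteSpace E] {H : Type*} [TopologicalSpace H] {I : ModelWithCorners ℝ E H}
  {M : Type*} [TopologicalSpace M] [ChartedSpace H M] [IsManifold I ∞ M]

/-- **The conjugate heat operator** `□* w = −∂ₜw − Δ_{g(t)} w + R w` of a family of metrics `g`
with connections `cov` on the time set `S` (Topping 2006, §6.3: "`□* := −∂/∂t − Δ + R`";
Perelman 2002, §3.1), acting on space-time functions `w : ℝ → M → ℝ`; `∂ₜ` is the one-sided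
derivative within `S` (`derivWithin`), `Δ_{g(t)}` the Laplace–Beltrami operator `laplaceBeltrami`,
`R` the scalar curvature `scalarCurvatureWith (g t) (cov t)`. [cite: Topping2006, §6.3] -/
def conjugateHeatOp (g : ℝ → PseudoRiemannianMetric I ∞ E (TangentSpace I : M → Type _))
    (cov : ℝ → CovariantDerivative I E (TangentSpace I : M → Type _)) (S : Set ℝ)
    (w : ℝ → M → ℝ) (t : ℝ) (x : M) : ℝ :=
  -derivWithin (fun s ↦ w s x) S t - (g t).laplaceBeltrami (w t) x +
    (g t).scalarCurvatureWith (cov t) x * w t x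

/-- Unfolding of `□*`. [cite: Topping2006, §6.3] -/
theorem conjugateHeatOp_apply (g : ℝ → PseudoRiemannianMetric I ∞ E (TangentSpace I : M → Type _))
    (cov : ℝ → CovariantDerivative I E (TangentSpace I : M → Type _)) (S : Set ℝ)
    (w : ℝ → M → ℝ) (t : ℝ) (x : M) :
    conjugateHeatOp g cov S w t x = -derivWithin (fun s ↦ w s x) S t -
      (g t).laplaceBeltrami (w t) x + (g t).scalarCurvatureWith (cov t) x * w t x := rfl

/-- **Topping's entropy integrand** `v = [τ(2Δf − |∇f|² + R) + f − n] u` (2006, (8.2.3)), for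
the family `(g, cov)`, a positive space-time function `u`, the dimension `n`, and
`τ = τ₀ − t`, `f = entropyPotential u n τ₀`: its integral against `dV_{g(t)}` is
`𝒲(g(t), f(t), τ)` (Rem. 8.2.7, `wEntropy_eq_integral_conjugateHeatIntegrand`), and Prop. 8.2.6
computes `□* v = −2τ|Ric + Hess f − g/2τ|² u`. [cite: Topping2006, §8.2, (8.2.3)] -/
def entropyIntegrand (g : ℝ → PseudoRiemannianMetric I ∞ E (TangentSpace I : M → Type _))
    (cov : ℝ → CovariantDerivative I E (TangentSpace I : M → Type _)) (u : ℝ → M → ℝ) (n : ℕ)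
    (τ₀ t : ℝ) (x : M) : ℝ :=
  ((τ₀ - t) * (2 * (g t).laplaceBeltrami (entropyPotential u n τ₀ t) x -
      (g t).gradSq (entropyPotential u n τ₀ t) x + (g t).scalarCurvatureWith (cov t) x) +
    entropyPotential u n τ₀ t x - n) * u t x

/-- Unfolding of `v`. [cite: Topping2006, §8.2, (8.2.3)] -/
theorem entropyIntegrand_apply (g : ℝ → PseudoRiemannianMetric I ∞ E (TangentSpace I : M → Type _))
    (cov : ℝ → CovariantDerivative I E (TangentSpace I : M → Type _)) (u : ℝ → M → ℝ) (n : ℕ)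
    (τ₀ t : ℝ) (x : M) :
    entropyIntegrand g cov u n τ₀ t x =
      ((τ₀ - t) * (2 * (g t).laplaceBeltrami (entropyPotential u n τ₀ t) x -
          (g t).gradSq (entropyPotential u n τ₀ t) x + (g t).scalarCurvatureWith (cov t) x) +
        entropyPotential u n τ₀ t x - n) * u t x := rfl

/-- **`u` is a smooth solution of the conjugate heat equation `□* u = 0` on `M × S`** (Topping
2006, Rem. 8.2.2; Perelman 2002, §3.1): `(x, t) ↦ u t x` is `C^∞` on `M × S` and
`∂ₜu = −Δ_{g(t)}u + Ru` at every `(x, t)`, `t ∈ S` (`derivWithin` encoding of the layer, as in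
`weakMaximumPrinciple`). [cite: Topping2006, §8.2, Rem. 8.2.2] -/
def IsConjugateHeatSolutionOn (g : ℝ → PseudoRiemannianMetric I ∞ E (TangentSpace I : M → Type _))
    (cov : ℝ → CovariantDerivative I E (TangentSpace I : M → Type _)) (S : Set ℝ)
    (u : ℝ → M → ℝ) : Prop :=
  ContMDiffOn (I.prod 𝓘(ℝ, ℝ)) 𝓘(ℝ, ℝ) ∞ (fun p : M × ℝ ↦ u p.2 p.1) (univ ×ˢ S) ∧
    ∀ t ∈ S, ∀ x, derivWithin (fun s ↦ u s x) S t =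
      -(g t).laplaceBeltrami (u t) x + (g t).scalarCurvatureWith (cov t) x * u t x

/-- A conjugate heat solution has `□* u = 0`. [cite: Topping2006, §8.2, Rem. 8.2.2] -/
theorem IsConjugateHeatSolutionOn.conjugateHeatOp_eq_zero
    {g : ℝ → PseudoRiemannianMetric I ∞ E (TangentSpace I : M → Type _)}
    {cov : ℝ → CovariantDerivative I E (TangentSpace I : M → Type _)} {S : Set ℝ}
    {u : ℝ → M → ℝ} (h : IsConjugateHeatSolutionOn g cov S u) {t : ℝ} (ht : t ∈ S) (x : M) :
    conjugateHeatOp g cov S u t x = 0 := by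
  rw [conjugateHeatOp_apply, h.2 t ht x]
  ring

end Defs

/-! ### The reduction of `perelman_noLocalCollapsing` in the named form -/

section Capstone

variable {m : ℕ} {H : Type v} [TopologicalSpace H]
  {I : ModelWithCorners ℝ (EuclideanSpace ℝ (Fin m)) H} [I.Boundaryless]
  {M : Type w} [TopologicalSpace M] [ChartedSpace H M] [IsManifold I ∞ M]
  [T2Space M] [CompactSpace M] [MeasurableSpace M] [BorelSpace M]
  {g : ℝ → PseudoRiemannianMetric I ∞ (EuclideanSpace ℝ (Fin m)) (TangentSpace I : M → Type _)}
  {cov : ℝ → CovariantDerivative I (EuclideanSpace ℝ (Fin m)) (TangentSpace I : M → Type _)}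

/-- **(EF)(b) from `□* v ≤ 0`** (Topping 2006, Prop. 8.2.6 ⇒ Prop. 8.2.1; Perelman 2002, (3.4)),
named form of `IsRicciFlow.monotoneOn_wEntropy_of_pointwise`: for a Ricci flow of Riemannian
metrics on `[0, T']`, `T' > 0`, on a closed manifold modelled on `ℝ^m`, `τ > 0`, and `u > 0`
smooth on `M × [0, T']`, if `□* v ≤ 0` on `M × [0, T']` for `v = entropyIntegrand g cov u m (τ + T')`,
then `t ↦ 𝒲(g(t), f(t), τ + T' − t)`, `f = entropyPotential u m (τ + T')`, is non-decreasing on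
`[0, T']`. [cite: Topping2006, §8.2, Prop. 8.2.1 and Prop. 8.2.6] [cite: Perelman2002, §3.1, (3.4)] -/
theorem IsRicciFlow.monotoneOn_wEntropy_of_conjugateHeatOp_entropyIntegrand_nonpos {T' : ℝ}
    (hT' : 0 < T') (h : IsRicciFlow g cov (Icc 0 T')) (hR : ∀ t ∈ Icc 0 T', (g t).IsRiemannian)
    {τ : ℝ} (hτ : 0 < τ) {u : ℝ → M → ℝ} (hpos : ∀ t ∈ Icc 0 T', ∀ x, 0 < u t x)
    (hu : ContMDiffOn (I.prod 𝓘(ℝ, ℝ)) 𝓘(ℝ, ℝ) ∞ (fun p : M × ℝ ↦ u p.2 p.1) (univ ×ˢ Icc 0 T'))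
    (hP : ∀ t ∈ Icc 0 T', ∀ x,
      conjugateHeatOp g cov (Icc 0 T') (entropyIntegrand g cov u m (τ + T')) t x ≤ 0) :
    MonotoneOn (fun t ↦ (g t).wEntropy (cov t) (entropyPotential u m (τ + T') t) (τ + T' - t))
      (Icc 0 T') :=
  h.monotoneOn_wEntropy_of_pointwise hT' hR hτ hpos hu hP

end Capstone

/-- **Perelman's no local collapsing theorem I from the conjugate heat flow and `□* v ≤ 0` on
manifolds modelled on `ℝ^m`** (named form of `perelman_noLocalCollapsing_of_conjugateHeat_pointwise`;
Perelman 2002, §3.1, (3.4) and §4, Thm. 4.1; Topping 2006, Rem. 8.2.5, Prop. 8.2.6, Prop. 8.2.1,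
(8.3.10), Thm. 8.3.1). Over all closed manifolds modelled on `EuclideanSpace ℝ (Fin m)` (all `m`)
carrying a Ricci flow of Riemannian metrics `(g, cov)` on `[0, T)`, and all `0 < t₀ < T`:
* `hCH` (**backward solvability of `□* u = 0`**, Topping Rem. 8.2.5 / (6.4.8)): every smooth
  positive `u₁` is the value at `t₀` of a positive conjugate heat solution on `[0, t₀]`
  (`IsConjugateHeatSolutionOn`);
* `hP` (**Topping's Prop. 8.2.6 as an inequality**; in print `□* v = −2τ|Ric + Hess f − g/2τ|² u`):
  along every positive conjugate heat solution `u` on `[0, t₀]` and for every `τ > 0`,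
  `□* v ≤ 0` on `M × [0, t₀]` for `v = entropyIntegrand g cov u m (τ + t₀)`.
Conclusion: `perelman_noLocalCollapsing` (every model space). NOT a discharge of the named
fact: (CH) is linear parabolic existence theory on closed manifolds, (P) is Perelman's pointwise
computation; neither is in Mathlib or the tree.
[cite: Perelman2002, §3.1, (3.4); §4, Thm. 4.1] [cite: Topping2006, §8.2, Prop. 8.2.6, Rem. 8.2.5; §8.3, Thm. 8.3.1] -/
theorem perelman_noLocalCollapsing_of_conjugateHeatSolution
    (hCH : ∀ (m : ℕ) {H : Type v} [TopologicalSpace H]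
      (I : ModelWithCorners ℝ (EuclideanSpace ℝ (Fin m)) H) [I.Boundaryless]
      (M : Type w) [TopologicalSpace M] [T2Space M] [SecondCountableTopology M] [CompactSpace M]
      [ChartedSpace H M] [IsManifold I ∞ M] [MeasurableSpace M] [BorelSpace M] (T : ℝ), 0 < T →
      ∀ (g : ℝ → PseudoRiemannianMetric I ∞ (EuclideanSpace ℝ (Fin m)) (TangentSpace I : M → Type _))
        (cov : ℝ → CovariantDerivative I (EuclideanSpace ℝ (Fin m)) (TangentSpace I : M → Type _)),
        IsRicciFlow g cov (Ico 0 T) → (∀ t ∈ Ico 0 T, (g t).IsRiemannian) →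
        ∀ t₀ ∈ Ioo 0 T, ∀ u₁ : M → ℝ, ContMDiff I 𝓘(ℝ, ℝ) ∞ u₁ → (∀ x, 0 < u₁ x) →
          ∃ u : ℝ → M → ℝ, u t₀ = u₁ ∧ (∀ t ∈ Icc 0 t₀, ∀ x, 0 < u t x) ∧
            IsConjugateHeatSolutionOn g cov (Icc 0 t₀) u)
    (hP : ∀ (m : ℕ) {H : Type v} [TopologicalSpace H]
      (I : ModelWithCorners ℝ (EuclideanSpace ℝ (Fin m)) H) [I.Boundaryless]
      (M : Type w) [TopologicalSpace M] [T2Space M] [SecondCountableTopology M] [CompactSpace M]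
      [ChartedSpace H M] [IsManifold I ∞ M] [MeasurableSpace M] [BorelSpace M] (T : ℝ), 0 < T →
      ∀ (g : ℝ → PseudoRiemannianMetric I ∞ (EuclideanSpace ℝ (Fin m)) (TangentSpace I : M → Type _))
        (cov : ℝ → CovariantDerivative I (EuclideanSpace ℝ (Fin m)) (TangentSpace I : M → Type _)),
        IsRicciFlow g cov (Ico 0 T) → (∀ t ∈ Ico 0 T, (g t).IsRiemannian) →
        ∀ t₀ ∈ Ioo 0 T, ∀ u : ℝ → M → ℝ, (∀ t ∈ Icc 0 t₀, ∀ x, 0 < u t x) →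
          IsConjugateHeatSolutionOn g cov (Icc 0 t₀) u →
          ∀ τ : ℝ, 0 < τ → ∀ t ∈ Icc 0 t₀, ∀ x,
            conjugateHeatOp g cov (Icc 0 t₀) (entropyIntegrand g cov u m (τ + t₀)) t x ≤ 0) :
    perelman_noLocalCollapsing.{u, v, w} :=
  perelman_noLocalCollapsing_of_conjugateHeat_pointwise
    (fun m _H _ I _ M _ _ _ _ _ _ _ _ T hT g cov hflow hRiem t₀ ht₀ u₁ hu₁ hu₁p ↦ by
      obtain ⟨u, huT, hpos, hsol⟩ := hCH m I M T hT g cov hflow hRiem t₀ ht₀ u₁ hu₁ hu₁p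
      exact ⟨u, huT, hpos, hsol.1, hsol.2⟩)
    (fun m _H _ I _ M _ _ _ _ _ _ _ _ T hT g cov hflow hRiem t₀ ht₀ u hpos hu hpde τ hτ ↦
      hP m I M T hT g cov hflow hRiem t₀ ht₀ u hpos ⟨hu, hpde⟩ τ hτ)

end Literature.Geometry.Riemannian

end
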